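import Summits.SmoothPoincare4.SmoothPoincare4.Theses.CongruenceShadows
import Literature.Topology.FourManifolds.SurfaceGroupGenusOne
import HarnessLib
import HarnessLib.Audit

/-!
# Line `unit-defect-dichotomy` for crux `CongruenceShadows.HeegaardHandlebodyCongruenceClosed` (stmt-SmoothPoincare4-14596)

Skeleton (crux-plan, round 1, idea `unit-defect-dichotomy`, triage r1-1/2/3: pass "decision line",
sharpenings acted on): **the crux's private content is a UNIT DEFECT — the gap between what finite
SHADOWS see (level stabilisers) and what PRODUCT-congruence sees (closures of `A∩B` and `C`) — and the
line is the `U⁻` branch of the card's dichotomy: the unit defect DETECTS `π₁ ≠ 1` on every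
Grothendieck flag, so congruence limits of products glue simply connected 4-manifolds; what is left
is the sibling crux `ShadowApproximation` (14595) on the twisted triples `T_ρ = (N₀, N₁, ρN₂)`.**
The `U⁺` branch (UPGRADE: shadow-standard ⟹ product-congruent on integral `ρ`) is NOT a stub of the
proving line — `ProductCongruent → ShadowStandard` is trivial (`shadowStandard_of_productCongruent`),
so UPGRADE is provably off the proving path; it is kernel-checked here in its two honest roles:
TIGHTNESS (`crux_iff_stubs_of_upgrade`: under UPGRADE the crux is EQUIVALENT to stub 2 ∧ stub 3) and
KILL-SWITCH (`not_crux_of_upgrade_of_ghost`: under UPGRADE one shadow-standard ghost flag — the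
Waldhausen-normalised trisection `y_H` of Kervaire's homology 4-sphere on Higman's group, if BLIND′ —
refutes the crux; exported to cdisprove).

Notation (existing declarations of `Literature.Topology.FourManifolds` and of the route file):
`S m = SurfaceGroup (3+3m)`, `N m = s4Kernels.stabilizeIter m` (standard `(3+3m; m+1)` triple of
`S⁴`), `Stab m i x : (N m i).map x = N m i`, `Carries m x ρ : x N₂ = ρ N₂`, `A∩B = Stab 0 ∩ Stab 1`,
`C = Stab 2`, `twisted m ρ = T_ρ = (N₀, N₁, ρN₂)`, `tripleJoin m ρ = N₀ ⊔ N₁ ⊔ ρN₂` (`= ⊤` iff the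
glued 4-manifold is simply connected, "`G_ρ = 1`"), `ProductCongruent` = the crux hypothesis,
`IsProduct` = the crux conclusion (`crux_iff : crux ↔ ∀ m ρ, ProductCongruent m ρ → IsProduct m ρ`
is `Iff.rfl`), `ShadowStandard m ρ` = all characteristic finite shadows of `T_ρ` are standard
(the hypothesis shape of the sibling cruxes `ShadowsStandard` / `ShadowApproximation`).

Chain (each arrow a registered stub; the glue is proved in §3):

  `ProductCongruent m ρ`
  —[proved: `shadowStandard_of_productCongruent`]→ `ShadowStandard m ρ`
  —[`stub_pairRigidity` ×2 (i = 0, 1; SHADOW form, triage r1-2 sharpening): Wilton–Zalesskii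
     profinite Kneser–Milnor + Perelman + Waldhausen 1968 + Dehn–Nielsen–Baer close the two
     Heegaard-PAIR products]→ `a ∈ A`, `b ∈ B` with `a N₂ = b N₂ = ρ N₂` (T_ρ has three standard pairs
     and trivial PROFINITE π₁: a Grothendieck flag unless `G_ρ = 1`)
  —[`stub_unitDefectDetects` (LOAD-BEARING, the line's private bet = branch U⁻): a Grothendieck flag
     with `G_ρ ≠ 1` fails product-congruence at SOME characteristic finite level — "the unit defect
     υ(ρ) ≠ 1 detects π₁" (Reidemeister-torsion-shaped: units modulo trivial units); PROVED here at
     `m = 0` (`unitDefectDetectsAt_zero`, cyclic collapse: §6); NECESSARY for the crux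
     (`unitDefectDetects_of_crux`, proved)]→ `tripleJoin m ρ = ⊤`
  —[`stub_fineGate` (= `ShadowApproximation` restricted to the triples `T_ρ`; the implication
     `ShadowApproximation → FineGate` is PROVED here, `fineGate_of_shadowApproximation`, via
     `isGroupTrisection_twisted`)]→ `IsProduct m ρ`.

`HeegaardHandlebodyCongruenceClosed_of_stubs : PairRigidity → UnitDefectDetects → FineGate → crux` is
sorry-free and `HeegaardHandlebodyCongruenceClosed_of : …CongruenceShadows.HeegaardHandlebodyCongruenceClosed`
applies it to the three stubs (type literally the route decl); sorries ONLY inside `stub_*`.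
Every stub is `∀ m, <Stub>At m`; §6 PROVES `UnitDefectDetectsAt 0` (genus 3 has no ghosts:
`S₃/(N₀ ⊔ N₁) ` is cyclic, and a cyclic group dying in every `ℤ/n`-homology level is trivial —
`tripleJoin_zero_eq_top_of_levels`, via `zmodMulEquivOfGenerator`), so at the first open type the
line is `hhccAt_zero_of : PairRigidityAt 0 → FineGateAt 0 → HHCCAt 0` (axioms: propext,
Classical.choice, Quot.sound).

Disproof.lean (cdisprove cycle 1, `Cruxes/HeegaardHandlebodyCongruenceClosed/Disproof.lean`, read
2026-08-16): honoured — (1) `cruxWithoutFiniteIndex_holds` (FiniteIndex is load-bearing): every level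
quantified here keeps `M.FiniteIndex`, and stub 2 produces a FINITE-INDEX characteristic level;
(2) `not_singleLevelSuffices` / `not_levelTwoSuffices` (one level, even `M₂`, never suffices): no stub
works at a single level — stub 1 and stub 3 consume ALL levels, stub 2 only asserts that SOME level
detects a ghost (its witness `ρ₁ = T_c²` is not a flag: its `(1,2)` pair is `L(3,1) # S¹×S²`);
(3) `not_conclusionUniversal` (`ρ₀ ∉ P`): `FineGate` carries the flag, shadow and `G_ρ = 1`
hypotheses (`ρ₀` fails them: `S₃/(N₁ ⊔ ρ₀N₂) = F₂`); (4) finding 2 (anatomy: a counterexample is a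
twisted triple with PROFINITELY trivial `G_ρ` — exotic `S⁴`, non-standard trisection of `S⁴`, or a
Kervaire–Higman homology sphere) is exactly the cut stub 3 / stub 3 / stub 2. Landed Negative lemmas
of the sibling cruxes checked against: `Theorems/ShadowApproximation/Negative/ShadowsOnlyFalse.lean`
(`shadowApproximation_false_without_isGroupTrisection`: shadows alone do not force `Iso`; the junk
slot `J₂ = N₂ ⊓ ker θ` is not of the form `ρN₂` — `FineGate`'s triples ARE group trisections of
`{1}`, `isGroupTrisection_twisted`), `Theorems/WaldhausenPairs/Negative/PairTransferFalse.lean`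
(`not_pairTransfer`: stabilisers do not transfer; `PairRigidity` concludes `∃ a` from a congruence
hypothesis on the PAIR, not from `α N_i = K_i`). `ledger negatives --problem SmoothPoincare4` = 0.
-/

noncomputable section

set_option linter.dupNamespace false

namespace Summit.SmoothPoincare4.SmoothPoincare4.Cruxes.HeegaardHandlebodyCongruenceClosed.UnitDefectDichotomy

open Literature.Topology.FourManifolds Subgroup
open Summit.SmoothPoincare4.SmoothPoincare4.Theses.CongruenceShadows
  (HeegaardHandlebodyCongruenceClosed ShadowApproximation)

/-! ## 0. Notation -/

/-- `S m = S_{3+3m}`, the surface group at the route's genus. -/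
abbrev S (m : ℕ) : Type := SurfaceGroup (3 + 3 * m)

/-- `N m = (N₀, N₁, N₂)`, the stabilised standard `S⁴` kernel triple of genus `3 + 3m`. -/
abbrev N (m : ℕ) : TrisectionKernels (3 + 3 * m) := s4Kernels.stabilizeIter m

/-- `x ∈ Stab(N m i)`. -/
abbrev Stab (m : ℕ) (i : Fin 3) (x : S m ≃* S m) : Prop := (N m i).map x.toMonoidHom = N m i

/-- `x` carries `N₂` onto `ρ N₂`. -/
abbrev Carries (m : ℕ) (x ρ : S m ≃* S m) : Prop :=
  (N m 2).map x.toMonoidHom = (N m 2).map ρ.toMonoidHom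

/-- `ρ ∈ (A∩B)·C·K_M`: product-congruent at the level `M`. -/
def ProductCongruentAt (m : ℕ) (ρ : S m ≃* S m) (M : Subgroup (S m)) : Prop :=
  ∃ x c : S m ≃* S m, Stab m 0 x ∧ Stab m 1 x ∧ Stab m 2 c ∧ ∀ s, ρ s * (x (c s))⁻¹ ∈ M

/-- The crux hypothesis for one `ρ`: product-congruent at every characteristic finite-index level. -/
def ProductCongruent (m : ℕ) (ρ : S m ≃* S m) : Prop :=
  ∀ M : Subgroup (S m), M.Characteristic → M.FiniteIndex → ProductCongruentAt m ρ M

/-- The crux conclusion for one `ρ`: `ρ ∈ (A∩B)·C`. -/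
def IsProduct (m : ℕ) (ρ : S m ≃* S m) : Prop :=
  ∃ x c : S m ≃* S m, Stab m 0 x ∧ Stab m 1 x ∧ Stab m 2 c ∧ ∀ s, ρ s = x (c s)

/-- Read-back (definitional): the crux is `∀ m ρ, ProductCongruent m ρ → IsProduct m ρ`. -/
theorem crux_iff :
    HeegaardHandlebodyCongruenceClosed ↔ ∀ (m : ℕ) (ρ : S m ≃* S m), ProductCongruent m ρ → IsProduct m ρ :=
  Iff.rfl

/-- The crux at one genus `3 + 3m`. -/
def HHCCAt (m : ℕ) : Prop := ∀ ρ : S m ≃* S m, ProductCongruent m ρ → IsProduct m ρ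

theorem crux_iff_forall : HeegaardHandlebodyCongruenceClosed ↔ ∀ m, HHCCAt m := Iff.rfl

/-- Shadow-standard at the level `M`: one automorphism carries the three `M`-shadows of the
standard triple onto those of `T_ρ = (N₀, N₁, ρN₂)` (the hypothesis shape of `ShadowApproximation`). -/
def ShadowStandardAt (m : ℕ) (ρ : S m ≃* S m) (M : Subgroup (S m)) : Prop :=
  ∃ ψ : S m ≃* S m, (N m 0 ⊔ M).map ψ.toMonoidHom = N m 0 ⊔ M ∧
    (N m 1 ⊔ M).map ψ.toMonoidHom = N m 1 ⊔ M ∧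
    (N m 2 ⊔ M).map ψ.toMonoidHom = (N m 2).map ρ.toMonoidHom ⊔ M

/-- All characteristic finite shadows of `T_ρ` are standard. -/
def ShadowStandard (m : ℕ) (ρ : S m ≃* S m) : Prop :=
  ∀ M : Subgroup (S m), M.Characteristic → M.FiniteIndex → ShadowStandardAt m ρ M

/-- The twisted triple `T_ρ = (N₀, N₁, ρ N₂)`. -/
def twisted (m : ℕ) (ρ : S m ≃* S m) : TrisectionKernels (3 + 3 * m) :=
  ![N m 0, N m 1, (N m 2).map ρ.toMonoidHom]

@[simp] theorem twisted_zero (m : ℕ) (ρ : S m ≃* S m) : twisted m ρ 0 = N m 0 := rfl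
@[simp] theorem twisted_one (m : ℕ) (ρ : S m ≃* S m) : twisted m ρ 1 = N m 1 := rfl
@[simp] theorem twisted_two (m : ℕ) (ρ : S m ≃* S m) :
    twisted m ρ 2 = (N m 2).map ρ.toMonoidHom := rfl

/-- `N₀ ⊔ N₁ ⊔ ρN₂`, the normal subgroup whose quotient is `G_ρ = π₁` of the 4-manifold glued by
`T_ρ`; `tripleJoin m ρ = ⊤` reads "`G_ρ = 1`". -/
abbrev tripleJoin (m : ℕ) (ρ : S m ≃* S m) : Subgroup (S m) :=
  N m 0 ⊔ N m 1 ⊔ (N m 2).map ρ.toMonoidHom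

/-! ## 1. Sorry-free basics -/

/-- The standard triple is a `(3+3m, m+1)` group trisection of `{1}` (two discharged named facts). -/
theorem N_isGroupTrisection (m : ℕ) : IsGroupTrisection (3 + 3 * m) (m + 1) (PUnit : Type) (N m) := by
  induction m with
  | zero => exact s4Kernels_isGroupTrisection_holds
  | succ m ih => exact stabilize_isGroupTrisection_holds _ _ _ _ ih

instance N_normal (m : ℕ) (i : Fin 3) : (N m i).Normal := (N_isGroupTrisection m).normal i

instance mapN_normal (m : ℕ) (i : Fin 3) (ρ : S m ≃* S m) : ((N m i).map ρ.toMonoidHom).Normal :=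
  Subgroup.Normal.map inferInstance _ ρ.surjective

/-- The standard triple normally generates `S`. -/
theorem normalClosure_iUnion_N (m : ℕ) : normalClosure (⋃ i, (N m i : Set (S m))) = ⊤ := by
  obtain ⟨e⟩ := (N_isGroupTrisection m).triple
  haveI : Subsingleton (TrisectionKernels.tripleQuotient (N m)) := e.toEquiv.subsingleton
  exact QuotientGroup.subgroup_eq_top_of_subsingleton _ inferInstance

/-- `N₀ ⊔ N₁ ⊔ N₂ = ⊤`. -/
theorem sup_N_eq_top (m : ℕ) : N m 0 ⊔ N m 1 ⊔ N m 2 = ⊤ := by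
  haveI h01 : (N m 0 ⊔ N m 1).Normal := Subgroup.sup_normal _ _
  haveI h012 : (N m 0 ⊔ N m 1 ⊔ N m 2).Normal := Subgroup.sup_normal _ _
  rw [eq_top_iff, ← normalClosure_iUnion_N m]
  refine normalClosure_le_normal (Set.iUnion_subset fun i => ?_)
  fin_cases i
  · exact fun s hs => mem_sup_left (mem_sup_left hs)
  · exact fun s hs => mem_sup_left (mem_sup_right hs)
  · exact fun s hs => mem_sup_right hs

/-- `map` along a composite automorphism. -/
theorem map_trans {m : ℕ} (e₁ e₂ : S m ≃* S m) (K : Subgroup (S m)) :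
    K.map (e₁.trans e₂).toMonoidHom = (K.map e₁.toMonoidHom).map e₂.toMonoidHom := by
  rw [Subgroup.map_map]; rfl

/-- Characteristic subgroups are fixed by automorphisms. -/
theorem map_eq_of_characteristic {m : ℕ} {M : Subgroup (S m)} (hM : M.Characteristic)
    (x : S m ≃* S m) : M.map x.toMonoidHom = M :=
  Subgroup.characteristic_iff_map_eq.1 hM x

/-- Pointwise congruence `ρ ≡ x ∘ c (mod M)` moves the image of any subgroup only within `M`. -/
theorem map_sup_eq_of_congr {m : ℕ} {ρ x c : S m ≃* S m} {M : Subgroup (S m)}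
    (h : ∀ s, ρ s * (x (c s))⁻¹ ∈ M) (H : Subgroup (S m)) :
    H.map ρ.toMonoidHom ⊔ M = (H.map c.toMonoidHom).map x.toMonoidHom ⊔ M := by
  apply le_antisymm
  · refine sup_le ?_ le_sup_right
    rintro _ ⟨s, hs, rfl⟩
    have : ρ s = (ρ s * (x (c s))⁻¹) * x (c s) := by group
    rw [MulEquiv.coe_toMonoidHom, this]
    exact mul_mem (mem_sup_right (h s)) (mem_sup_left ⟨c s, ⟨s, hs, rfl⟩, rfl⟩)
  · refine sup_le ?_ le_sup_right
    rintro _ ⟨_, ⟨s, hs, rfl⟩, rfl⟩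
    have : x (c s) = (ρ s * (x (c s))⁻¹)⁻¹ * ρ s := by group
    rw [MulEquiv.coe_toMonoidHom, MulEquiv.coe_toMonoidHom, this]
    exact mul_mem (mem_sup_right (inv_mem (h s))) (mem_sup_left ⟨s, hs, rfl⟩)

/-- Product-congruent ⟹ shadow-standard, level by level (the TRIVIAL direction; its converse on
integral points is the card's conjecture UPGRADE, §5). The witness is `ψ := x_M`. -/
theorem shadowStandardAt_of_productCongruentAt {m : ℕ} {ρ : S m ≃* S m} {M : Subgroup (S m)}
    (hM : M.Characteristic) (h : ProductCongruentAt m ρ M) : ShadowStandardAt m ρ M := by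
  obtain ⟨x, c, hx0, hx1, hc2, hs⟩ := h
  have hxM : M.map x.toMonoidHom = M := map_eq_of_characteristic hM x
  refine ⟨x, ?_, ?_, ?_⟩
  · rw [Subgroup.map_sup, hxM, hx0]
  · rw [Subgroup.map_sup, hxM, hx1]
  · rw [Subgroup.map_sup, hxM, map_sup_eq_of_congr hs (N m 2), hc2]

theorem shadowStandard_of_productCongruent {m : ℕ} {ρ : S m ≃* S m} (h : ProductCongruent m ρ) :
    ShadowStandard m ρ := fun M hM hF =>
  shadowStandardAt_of_productCongruentAt hM (h M hM hF)

/-- The crux conclusion for `ρ` is exactly `Iso N T_ρ` (so on twisted triples the conclusion of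
`ShadowApproximation` IS the crux conclusion). -/
theorem isProduct_iff_iso (m : ℕ) (ρ : S m ≃* S m) :
    IsProduct m ρ ↔ TrisectionKernels.Iso (N m) (twisted m ρ) := by
  constructor
  · rintro ⟨x, c, hx0, hx1, hc, hs⟩
    refine ⟨x, fun i => ?_⟩
    fin_cases i
    · exact hx0
    · exact hx1
    · show (N m 2).map x.toMonoidHom = twisted m ρ 2
      rw [twisted_two]
      have hρ : ρ = c.trans x := MulEquiv.ext fun s => hs s
      rw [hρ, map_trans, hc]
  · rintro ⟨α, hα⟩
    have h0 : (N m 0).map α.toMonoidHom = N m 0 := by simpa using hα 0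
    have h1 : (N m 1).map α.toMonoidHom = N m 1 := by simpa using hα 1
    have h2 : (N m 2).map α.toMonoidHom = (N m 2).map ρ.toMonoidHom := by simpa using hα 2
    refine ⟨α, ρ.trans α.symm, h0, h1, ?_, fun s => by simp⟩
    show (N m 2).map (ρ.trans α.symm).toMonoidHom = N m 2
    rw [map_trans, ← h2, ← map_trans]
    have : (α.trans α.symm).toMonoidHom = MonoidHom.id _ := MonoidHom.ext fun s => by simp
    rw [this, Subgroup.map_id]

/-- A product carrier kills the triple quotient: `x ∈ A∩B` with `x N₂ = ρ N₂` ⟹ `G_ρ = 1`. -/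
theorem tripleJoin_eq_top_of_carrier {m : ℕ} {ρ x : S m ≃* S m} (h0 : Stab m 0 x) (h1 : Stab m 1 x)
    (h2 : Carries m x ρ) : tripleJoin m ρ = ⊤ := by
  have hx : Function.Surjective x.toMonoidHom := x.surjective
  have h2' : (N m 2).map x.toMonoidHom = (N m 2).map ρ.toMonoidHom := h2
  rw [eq_top_iff, ← Subgroup.map_top_of_surjective _ hx, ← sup_N_eq_top m, Subgroup.map_sup,
    Subgroup.map_sup, h0, h1, h2']

/-- NECESSARY CONDITION: `ρ ∈ (A∩B)·C ⟹ G_ρ = 1`. -/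
theorem tripleJoin_eq_top_of_isProduct {m : ℕ} {ρ : S m ≃* S m} (h : IsProduct m ρ) :
    tripleJoin m ρ = ⊤ := by
  obtain ⟨x, c, h0, h1, h2, hs⟩ := h
  have hρ : ρ = c.trans x := MulEquiv.ext fun s => hs s
  refine tripleJoin_eq_top_of_carrier h0 h1 ?_
  show (N m 2).map x.toMonoidHom = (N m 2).map ρ.toMonoidHom
  rw [hρ, map_trans, h2]

/-- crux ⟹ "congruence limits of products are simply connected" (unconditional). -/
theorem tripleJoin_eq_top_of_crux (hC : HeegaardHandlebodyCongruenceClosed) {m : ℕ} {ρ : S m ≃* S m}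
    (hρ : ProductCongruent m ρ) : tripleJoin m ρ = ⊤ :=
  tripleJoin_eq_top_of_isProduct (crux_iff.1 hC m ρ hρ)

/-! ## 2. The three registered stubs -/

/-- STUB 1 statement — PAIR RIGIDITY (shadow form). For `i = 0, 1`: if at every characteristic
finite-index level ONE automorphism carries the `M`-shadow of the standard pair `(Nᵢ, N₂)` (a
genus-`g` Heegaard pair of `#ᵏ(S¹×S²)`, `k = m+1`) onto that of `(Nᵢ, ρN₂)`, then some `a ∈ Stab Nᵢ`
carries `N₂` onto `ρN₂` on the nose. -/
def PairRigidityAt (m : ℕ) : Prop :=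
  ∀ (i : Fin 3), i ≠ 2 → ∀ ρ : S m ≃* S m,
    (∀ M : Subgroup (S m), M.Characteristic → M.FiniteIndex →
      ∃ a : S m ≃* S m, (N m i ⊔ M).map a.toMonoidHom = N m i ⊔ M ∧
        (N m 2 ⊔ M).map a.toMonoidHom = (N m 2).map ρ.toMonoidHom ⊔ M) →
    ∃ a : S m ≃* S m, Stab m i a ∧ Carries m a ρ

/-- STUB 1 at every genus. -/
def PairRigidity : Prop := ∀ m : ℕ, PairRigidityAt m

/-- **`stub_pairRigidity`** (theorem-grade, vendoring XL; shared with the merged line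
`pair-rigidity-retraction`). Route: the level-`M` quotients of `G₁ = S/(Nᵢ ⊔ ρN₂)` and of
`S/(Nᵢ ⊔ N₂) ≅ F_k` are isomorphic via `a_M` and characteristic finite-index levels are cofinal, so
`Ĝ₁ ≅ F̂_k` (Dixon–Formanek–Poland–Ribes); `G₁ = π₁(Hᵢ ∪_ρ H₂)` is a closed orientable 3-manifold
group (Dehn–Nielsen–Baer; Leininger–Reid Lemma 2.2 / Jaco), so by Wilton–Zalesskii's profinite
Kneser–Milnor theorem (arXiv:1703.03701 Thm 1 = Thm 2.2: `m = n, r = s`) with Perelman,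
`Hᵢ ∪_ρ H₂ ≅ #ᵏ(S¹×S²)`; Waldhausen 1968: its genus-`g` splitting is standard; Dehn–Nielsen–Baer
turns the diffeomorphism of triples `(Σ; Hᵢ, H₂) → (Σ; Hᵢ, ρH₂)` into `a`. -/
theorem stub_pairRigidity : PairRigidity := by
  sorry

/-- STUB 2 statement — THE UNIT DEFECT DETECTS π₁ (branch `U⁻` of the card; = "limits are simply
connected" restricted to Grothendieck flags, in detection form). A pair-normalised (`a`, `b`),
shadow-standard `ρ` whose glued 4-manifold is NOT simply connected (`N₀ ⊔ N₁ ⊔ ρN₂ ≠ ⊤`; its `G_ρ`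
is then a non-trivial group with trivial profinite completion, e.g. Higman's) fails
product-congruence at SOME characteristic finite-index level. -/
def UnitDefectDetectsAt (m : ℕ) : Prop :=
  ∀ (ρ a b : S m ≃* S m), Stab m 0 a → Carries m a ρ → Stab m 1 b → Carries m b ρ →
    ShadowStandard m ρ → tripleJoin m ρ ≠ ⊤ →
    ∃ M : Subgroup (S m), M.Characteristic ∧ M.FiniteIndex ∧ ¬ ProductCongruentAt m ρ M

/-- STUB 2 at every genus (at `m = 0` it is PROVED below: `unitDefectDetectsAt_zero`). -/
def UnitDefectDetects : Prop := ∀ m : ℕ, UnitDefectDetectsAt m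

/-- **`stub_unitDefectDetects`** (LOAD-BEARING; open for `m ≥ 1`; NECESSARY for the crux by
`unitDefectDetects_of_crux`; PROVED at `m = 0` by `unitDefectDetectsAt_zero` (§6), where `G_ρ` is a
quotient of `S/(N₀ ⊔ N₁) ≅ ℤ` with trivial profinite completion). Logically it is "limits are simply
connected" on Grothendieck flags, in detection form; the unit defect is this line's proposed PROOF
MECHANISM, not part of the statement. Mechanism proposed by the card: the defect
`υ(ρ) ∈ Ȟ∖Ȟ⁺·Č⁺/Č` (level stabilisers modulo closures: profinite unit tori, `det = 2` on
`L₀ ⊗ 𝔽_ℓ`) is the only datum of the hypothesis that is not a congruence-continuous function of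
`ρ`; on a flag with `π₁ ≠ 1` it should be non-trivial in `K₁`-type data of `ℤ[S/M]`-modules at a
solvable-non-nilpotent or non-solvable level (abelian and nilpotent levels are blind: class number
one / Nakayama). Cheapest falsifier: the Kervaire–Higman flag `y_H` at `M = ⋂ ker(S ↠ A₅)` AND an
abelian-exponent level (two-level test, triage r1-2). -/
theorem stub_unitDefectDetects : UnitDefectDetects := by
  sorry

/-- STUB 3 statement — FINE GATE (= the sibling crux `ShadowApproximation`, stmt-SmoothPoincare4-14595,
restricted to the twisted triples `T_ρ`; `fineGate_of_shadowApproximation` below PROVES the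
restriction). A pair-normalised, shadow-standard `T_ρ` with `G_ρ = 1` — i.e. a `(3+3m; m+1)` group
trisection of `{1}` of the form `(N₀, N₁, ρN₂)` all of whose characteristic finite shadows are
standard (`isGroupTrisection_twisted`) — is standard: `ρ ∈ (A∩B)·C`. -/
def FineGateAt (m : ℕ) : Prop :=
  ∀ (ρ a b : S m ≃* S m), Stab m 0 a → Carries m a ρ → Stab m 1 b → Carries m b ρ →
    ShadowStandard m ρ → tripleJoin m ρ = ⊤ → IsProduct m ρ

/-- STUB 3 at every genus. -/
def FineGate : Prop := ∀ m : ℕ, FineGateAt m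

/-- **`stub_fineGate`** (open-problem strength: `SPC4_g ∧` 4-d Waldhausen on its locus, exactly as
the sibling crux it restricts; shared with 14595's lines `free-shadow-tsystem` /
`weakly-reducible-knot-rigidity`). Under UPGRADE it is also NECESSARY for the crux
(`fineGate_of_upgrade_of_crux`); its product-congruent weakening `FineApprox` (§5) is necessary
unconditionally and is the triage's repaired crux "14596 with `N₀ ⊔ N₁ ⊔ ρN₂ = ⊤` added". -/
theorem stub_fineGate : FineGate := by
  sorry

/-! ## 3. Composition (sorry-free glue): the three stubs prove the crux BY NAME -/

/-- The glue at one genus: given `ρ` product-congruent at all levels, shadows are standard (§1);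
pair rigidity at `i = 0, 1` gives the flag `(a, b)`; were `G_ρ ≠ 1`, stub 2 would exhibit a level
refusing product-congruence, contradicting the hypothesis; so `G_ρ = 1` and the fine gate closes. -/
theorem hhccAt_of_stubs (m : ℕ) (hPR : PairRigidityAt m) (hUD : UnitDefectDetectsAt m)
    (hFG : FineGateAt m) : HHCCAt m := by
  intro ρ hPC
  have hSS : ShadowStandard m ρ := shadowStandard_of_productCongruent hPC
  obtain ⟨a, ha, ha'⟩ := hPR 0 (by decide) ρ fun M hM hF => by
    obtain ⟨ψ, h0, -, h2⟩ := hSS M hM hF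
    exact ⟨ψ, h0, h2⟩
  obtain ⟨b, hb, hb'⟩ := hPR 1 (by decide) ρ fun M hM hF => by
    obtain ⟨ψ, -, h1, h2⟩ := hSS M hM hF
    exact ⟨ψ, h1, h2⟩
  have htop : tripleJoin m ρ = ⊤ := by
    by_contra hne
    obtain ⟨M, hM, hF, hnot⟩ := hUD ρ a b ha ha' hb hb' hSS hne
    exact hnot (hPC M hM hF)
  exact hFG ρ a b ha ha' hb hb' hSS htop

/-- The glue at all genera: `PairRigidity → UnitDefectDetects → FineGate → crux`. -/
theorem HeegaardHandlebodyCongruenceClosed_of_stubs (hPR : PairRigidity) (hUD : UnitDefectDetects)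
    (hFG : FineGate) : HeegaardHandlebodyCongruenceClosed :=
  crux_iff_forall.2 fun m => hhccAt_of_stubs m (hPR m) (hUD m) (hFG m)

/-- **Composition.** The three stubs prove the crux `CongruenceShadows.HeegaardHandlebodyCongruenceClosed`
BY NAME. -/
theorem HeegaardHandlebodyCongruenceClosed_of :
    _root_.Summit.SmoothPoincare4.SmoothPoincare4.Theses.CongruenceShadows.HeegaardHandlebodyCongruenceClosed :=
  HeegaardHandlebodyCongruenceClosed_of_stubs stub_pairRigidity stub_unitDefectDetects stub_fineGate

/-! ## 4. Certificates (sorry-free): stub 2 is necessary; stub 3 is a restriction of the sibling crux -/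

/-- STUB 2 IS NECESSARY: the crux implies `UnitDefectDetects` (contrapositive of
`tripleJoin_eq_top_of_crux`). So if the Kervaire–Higman flag turns out product-congruent at all
levels, stub 2 AND the crux die together (route kill criterion: drop/restate rank 6), never stub 2
alone. -/
theorem unitDefectDetects_of_crux (hC : HeegaardHandlebodyCongruenceClosed) : UnitDefectDetects := by
  intro m ρ a b _ _ _ _ _ hG
  by_contra hall
  apply hG
  refine tripleJoin_eq_top_of_crux hC fun M hM hF => ?_
  by_contra hnot
  exact hall ⟨M, hM, hF, hnot⟩

/-- Transport of a normal-closure quotient of `S` along an automorphism. -/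
theorem map_normalClosure_eq {m : ℕ} (α : S m ≃* S m) (s : Set (S m)) :
    (normalClosure s).map α.toMonoidHom = normalClosure (α '' s) := by
  rw [Subgroup.map_normalClosure _ _ (by exact α.surjective)]
  rfl

/-- The image of a subgroup as a set. -/
theorem image_coe_eq {m : ℕ} {α : S m ≃* S m} {K K' : Subgroup (S m)}
    (h : K.map α.toMonoidHom = K') : α '' (K : Set (S m)) = (K' : Set (S m)) := by
  rw [← h]
  rfl

/-- Freeness of a normal-closure quotient is transported along an automorphism. -/
theorem isFreeOfRank_transport {m k : ℕ} (α : S m ≃* S m) {s t : Set (S m)} (h : α '' s = t)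
    (hs : IsFreeOfRank (S m ⧸ normalClosure s) k) : IsFreeOfRank (S m ⧸ normalClosure t) k := by
  refine hs.of_mulEquiv (QuotientGroup.congr (normalClosure s) (normalClosure t) α ?_)
  change (normalClosure s).map α.toMonoidHom = normalClosure t
  rw [map_normalClosure_eq, h]

theorem le_normalClosure_twisted (m : ℕ) (ρ : S m ≃* S m) (i : Fin 3) :
    twisted m ρ i ≤ normalClosure (⋃ i, (twisted m ρ i : Set (S m))) := fun _ hs =>
  subset_normalClosure (Set.mem_iUnion.2 ⟨i, hs⟩)

/-- **A pair-normalised twisted triple with `G_ρ = 1` is a `(3+3m; m+1)` group trisection of the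
trivial group.** `normal`: images of normal subgroups; `free_quotient`: `S/ρN₂ ≅ S/N₂` via `ρ`;
`free_pairQuotient`: `(0,1)` is the standard pair, `(0,2)` / `(1,2)` are transported along `a` / `b`;
`triple`: `tripleJoin = ⊤`. (This is the bookkeeping of the companion card's `GateRetraction`,
and the reason `FineGate` honours `shadowApproximation_false_without_isGroupTrisection`.) -/
theorem isGroupTrisection_twisted {m : ℕ} {ρ a b : S m ≃* S m}
    (ha : Stab m 0 a) (ha' : Carries m a ρ) (hb : Stab m 1 b) (hb' : Carries m b ρ)
    (htop : tripleJoin m ρ = ⊤) :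
    IsGroupTrisection (3 + 3 * m) (m + 1) (PUnit : Type) (twisted m ρ) := by
  have hN := N_isGroupTrisection m
  -- the four transported pair quotients, as set identities
  have sa : a '' ((N m 0 : Set (S m)) ∪ (N m 2 : Set (S m))) =
      (N m 0 : Set (S m)) ∪ ((N m 2).map ρ.toMonoidHom : Set (S m)) := by
    rw [Set.image_union, image_coe_eq ha, image_coe_eq ha']
  have sa' : a '' ((N m 2 : Set (S m)) ∪ (N m 0 : Set (S m))) =
      ((N m 2).map ρ.toMonoidHom : Set (S m)) ∪ (N m 0 : Set (S m)) := by
    rw [Set.image_union, image_coe_eq ha, image_coe_eq ha']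
  have sb : b '' ((N m 1 : Set (S m)) ∪ (N m 2 : Set (S m))) =
      (N m 1 : Set (S m)) ∪ ((N m 2).map ρ.toMonoidHom : Set (S m)) := by
    rw [Set.image_union, image_coe_eq hb, image_coe_eq hb']
  have sb' : b '' ((N m 2 : Set (S m)) ∪ (N m 1 : Set (S m))) =
      ((N m 2).map ρ.toMonoidHom : Set (S m)) ∪ (N m 1 : Set (S m)) := by
    rw [Set.image_union, image_coe_eq hb, image_coe_eq hb']
  have s2 : ρ '' (N m 2 : Set (S m)) = ((N m 2).map ρ.toMonoidHom : Set (S m)) := image_coe_eq rfl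
  refine ⟨?_, ?_, ?_, ?_⟩
  · intro i
    fin_cases i
    · exact hN.normal 0
    · exact hN.normal 1
    · exact mapN_normal m 2 ρ
  · intro i
    fin_cases i
    · exact hN.free_quotient 0
    · exact hN.free_quotient 1
    · exact isFreeOfRank_transport ρ s2 (hN.free_quotient 2)
  · intro i j hij
    fin_cases i <;> fin_cases j
    · exact absurd rfl hij
    · exact hN.free_pairQuotient 0 1 (by decide)
    · exact isFreeOfRank_transport a sa (hN.free_pairQuotient 0 2 (by decide))
    · exact hN.free_pairQuotient 1 0 (by decide)
    · exact absurd rfl hij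
    · exact isFreeOfRank_transport b sb (hN.free_pairQuotient 1 2 (by decide))
    · exact isFreeOfRank_transport a sa' (hN.free_pairQuotient 2 0 (by decide))
    · exact isFreeOfRank_transport b sb' (hN.free_pairQuotient 2 1 (by decide))
    · exact absurd rfl hij
  · have hle : (⊤ : Subgroup (S m)) ≤ normalClosure (⋃ i, (twisted m ρ i : Set (S m))) := by
      rw [← htop]
      refine sup_le (sup_le ?_ ?_) ?_
      · exact le_normalClosure_twisted m ρ 0
      · exact le_normalClosure_twisted m ρ 1
      · exact le_normalClosure_twisted m ρ 2
    have heq : normalClosure (⋃ i, (twisted m ρ i : Set (S m))) = ⊤ := eq_top_iff.2 hle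
    haveI : Subsingleton ((twisted m ρ).tripleQuotient) := by
      change Subsingleton (S m ⧸ normalClosure (⋃ i, (twisted m ρ i : Set (S m))))
      rw [heq]
      exact QuotientGroup.subsingleton_quotient_top
    letI : Unique ((twisted m ρ).tripleQuotient) := uniqueOfSubsingleton 1
    exact ⟨MulEquiv.ofUnique⟩

/-- **STUB 3 IS A RESTRICTION OF THE SIBLING CRUX**: `ShadowApproximation` (stmt-SmoothPoincare4-14595)
implies `FineGate`. The pair automorphisms demanded by `ShadowApproximation` are `id`, `a`, `b`; its
shadow hypothesis is `ShadowStandard`; its conclusion `Iso N T_ρ` is `IsProduct` (`isProduct_iff_iso`). -/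
theorem fineGate_of_shadowApproximation (h : ShadowApproximation) : FineGate := by
  intro m ρ a b ha ha' hb hb' hSS htop
  have hK := isGroupTrisection_twisted ha ha' hb hb' htop
  refine (isProduct_iff_iso m ρ).2 (h m (twisted m ρ) hK ?_ ?_)
  · intro i j hij
    fin_cases i <;> fin_cases j
    · exact absurd rfl hij
    · exact ⟨MulEquiv.refl _, by simp, by simp⟩
    · exact ⟨a, ha, ha'⟩
    · exact ⟨MulEquiv.refl _, by simp, by simp⟩
    · exact absurd rfl hij
    · exact ⟨b, hb, hb'⟩
    · exact ⟨a, ha', ha⟩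
    · exact ⟨b, hb', hb⟩
    · exact absurd rfl hij
  · intro M hM hF
    obtain ⟨ψ, h0, h1, h2⟩ := hSS M hM hF
    refine ⟨ψ, fun i => ?_⟩
    fin_cases i
    · exact h0
    · exact h1
    · exact h2

/-! ## 5. The dichotomy (branch `U⁺`, sorry-free): UPGRADE, tightness, and the kill-switch -/

/-- **UPGRADE** (the card's conjecture; "rationality kills units": local–global for the unit
defect on INTEGRAL points). For `ρ ∈ Aut S`, shadow-standard at all characteristic finite levels
already forces product-congruence at all of them. Only ever in this ALL-LEVELS form (triage r1-2
App. B / r1-3 §B(3): a single abelian level carries a square-class defect, `γ = [[2,5],[5,13]] ⊕ I₄`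
at `ℓ = 5`). NOT a stub of the proving line: `ProductCongruent → ShadowStandard` is the trivial
direction, so no hypothesis of `HeegaardHandlebodyCongruenceClosed_of_stubs` needs it. -/
def Upgrade : Prop :=
  ∀ (m : ℕ) (ρ : S m ≃* S m), ShadowStandard m ρ → ProductCongruent m ρ

/-- The abelian level of exponent `n`: `[S,S]·Sⁿ` (characteristic; finite index for `n ≥ 1`). -/
def abelianLevel (m n : ℕ) : Subgroup (S m) :=
  commutator (S m) ⊔ Subgroup.closure (Set.range fun s : S m => s ^ n)

/-- **ABELIAN UPGRADE** — the first rung of UPGRADE, TRUE by hand (`Sp_{6k}(ℤ) ∩ P₀₁(Ẑ)·P₂(Ẑ) =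
P₀₁(ℤ)·P₂(ℤ)`: class number one of the split torus / adapted integral symplectic bases; triage
r1-2 Appendix A, r1-3 §B(2)), provable in tree modulo the classical surjectivities
`A∩B ↠ (P₀∩P₁)(ℤ)^±`, `C ↠ P₂(ℤ)^±` (Goeritz / handlebody groups onto integral Lagrangian
stabilisers). Recorded as the line's provable-now target for idle provers, not a stub. -/
def AbelianUpgrade : Prop :=
  ∀ (m : ℕ) (ρ : S m ≃* S m), (∀ n : ℕ, 0 < n → ShadowStandardAt m ρ (abelianLevel m n)) →
    ∀ n : ℕ, 0 < n → ProductCongruentAt m ρ (abelianLevel m n)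

/-- `FineApprox` — the product-congruent weakening of `FineGate`: the crux with the hypothesis
`G_ρ = 1` (and the flag) added, i.e. the triage's repaired item. -/
def FineApprox : Prop :=
  ∀ (m : ℕ) (ρ a b : S m ≃* S m), Stab m 0 a → Carries m a ρ → Stab m 1 b → Carries m b ρ →
    ProductCongruent m ρ → tripleJoin m ρ = ⊤ → IsProduct m ρ

theorem fineApprox_of_fineGate (h : FineGate) : FineApprox :=
  fun m ρ a b ha ha' hb hb' hPC htop =>
    h m ρ a b ha ha' hb hb' (shadowStandard_of_productCongruent hPC) htop

/-- `FineApprox` is NECESSARY for the crux (it is a weakening). -/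
theorem fineApprox_of_crux (hC : HeegaardHandlebodyCongruenceClosed) : FineApprox :=
  fun m ρ _ _ _ _ _ _ hPC _ => crux_iff.1 hC m ρ hPC

/-- Under UPGRADE the two forms of the gate coincide: this is exactly where UPGRADE sits — between
the crux's own residual (`FineApprox`) and the sibling crux's restriction (`FineGate`). -/
theorem fineGate_of_upgrade_of_fineApprox (hU : Upgrade) (h : FineApprox) : FineGate :=
  fun m ρ a b ha ha' hb hb' hSS htop => h m ρ a b ha ha' hb hb' (hU m ρ hSS) htop

/-- Under UPGRADE stub 3 is NECESSARY for the crux. -/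
theorem fineGate_of_upgrade_of_crux (hU : Upgrade) (hC : HeegaardHandlebodyCongruenceClosed) : FineGate :=
  fineGate_of_upgrade_of_fineApprox hU (fineApprox_of_crux hC)

/-- **TIGHTNESS (the card's Transfer, kernel-checked).** Given printed pair rigidity and UPGRADE,
the crux is EQUIVALENT to stub 2 ∧ stub 3: `U⁻`-detection on Grothendieck flags and
`ShadowApproximation` on twisted triples. -/
theorem crux_iff_stubs_of_upgrade (hU : Upgrade) (hPR : PairRigidity) :
    HeegaardHandlebodyCongruenceClosed ↔ (UnitDefectDetects ∧ FineGate) :=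
  ⟨fun hC => ⟨unitDefectDetects_of_crux hC, fineGate_of_upgrade_of_crux hU hC⟩,
    fun h => HeegaardHandlebodyCongruenceClosed_of_stubs hPR h.1 h.2⟩

/-- Unconditional tightness with the product-congruent gate. -/
theorem crux_iff_stubs (hPR : PairRigidity) :
    HeegaardHandlebodyCongruenceClosed ↔ (UnitDefectDetects ∧ FineApprox) := by
  refine ⟨fun hC => ⟨unitDefectDetects_of_crux hC, fineApprox_of_crux hC⟩, fun h => ?_⟩
  refine crux_iff.2 fun m ρ hPC => ?_
  have hSS : ShadowStandard m ρ := shadowStandard_of_productCongruent hPC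
  obtain ⟨a, ha, ha'⟩ := hPR m 0 (by decide) ρ fun M hM hF => by
    obtain ⟨ψ, h0, -, h2⟩ := hSS M hM hF
    exact ⟨ψ, h0, h2⟩
  obtain ⟨b, hb, hb'⟩ := hPR m 1 (by decide) ρ fun M hM hF => by
    obtain ⟨ψ, -, h1, h2⟩ := hSS M hM hF
    exact ⟨ψ, h1, h2⟩
  have htop : tripleJoin m ρ = ⊤ := by
    by_contra hne
    obtain ⟨M, hM, hF, hnot⟩ := h.1 m ρ a b ha ha' hb hb' hSS hne
    exact hnot (hPC M hM hF)
  exact h.2 m ρ a b ha ha' hb hb' hPC htop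

/-- **KILL-SWITCH (branch `U⁺`, exported to cdisprove).** Under UPGRADE a single shadow-standard
`ρ` whose glued 4-manifold is not simply connected refutes the crux. The intended witness is the
Waldhausen-normalised balanced trisection `y_H` of Kervaire's homology 4-sphere on Higman's group
(`G = Higman ≠ 1`, `Ĝ = 1`), for which BLIND′ predicts `ShadowStandard m y_H`. -/
theorem not_crux_of_upgrade_of_ghost (hU : Upgrade) {m : ℕ} {ρ : S m ≃* S m}
    (hS : ShadowStandard m ρ) (hG : tripleJoin m ρ ≠ ⊤) : ¬ HeegaardHandlebodyCongruenceClosed :=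
  fun hC => hG (tripleJoin_eq_top_of_crux hC (hU m ρ hS))

/-- Without UPGRADE the kill needs the PRODUCT hypothesis on the ghost (this is the disprover's
exact target: "`y_H` lies in the fine closure"). -/
theorem not_crux_of_productCongruent_ghost {m : ℕ} {ρ : S m ≃* S m}
    (hP : ProductCongruent m ρ) (hG : tripleJoin m ρ ≠ ⊤) : ¬ HeegaardHandlebodyCongruenceClosed :=
  fun hC => hG (tripleJoin_eq_top_of_crux hC hP)

/-- **THE DICHOTOMY on one ghost** (`G_ρ ≠ 1`): either some characteristic finite level refuses
product-congruence (`U⁻`: the unit defect detects `π₁`, the ghost is invisible to the crux), or the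
ghost is a congruence limit of products and the crux is false (`U⁺`). -/
theorem ghost_dichotomy {m : ℕ} {ρ : S m ≃* S m} (hG : tripleJoin m ρ ≠ ⊤) :
    (∃ M : Subgroup (S m), M.Characteristic ∧ M.FiniteIndex ∧ ¬ ProductCongruentAt m ρ M) ∨
      (ProductCongruent m ρ ∧ ¬ HeegaardHandlebodyCongruenceClosed) := by
  by_cases h : ProductCongruent m ρ
  · exact Or.inr ⟨h, not_crux_of_productCongruent_ghost h hG⟩
  · refine Or.inl ?_
    by_contra hall
    apply h
    intro M hM hF
    by_contra hnot
    exact hall ⟨M, hM, hF, hnot⟩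

/-! ## 6. Genus 3 (`m = 0`): no ghosts — stub 2 is PROVED at the first open type, and the line
there is `PairRigidityAt 0 ∧ FineGateAt 0` (sorry-free) -/

/-- Level collapse: a shadow-standard `T_ρ` has `(N₀ ⊔ N₁ ⊔ ρN₂) ⊔ M = ⊤` at that level, i.e.
`G_ρ` dies in every characteristic finite quotient (its profinite completion is trivial). -/
theorem tripleJoin_sup_eq_top_of_shadowStandardAt {m : ℕ} {ρ : S m ≃* S m} {M : Subgroup (S m)}
    (h : ShadowStandardAt m ρ M) : tripleJoin m ρ ⊔ M = ⊤ := by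
  obtain ⟨ψ, h0, h1, h2⟩ := h
  have i0 : N m 0 ≤ tripleJoin m ρ := le_sup_left.trans le_sup_left
  have i1 : N m 1 ≤ tripleJoin m ρ := le_sup_right.trans le_sup_left
  have i2 : (N m 2).map ρ.toMonoidHom ≤ tripleJoin m ρ := le_sup_right
  have k0 : (N m 0).map ψ.toMonoidHom ≤ tripleJoin m ρ ⊔ M :=
    (Subgroup.map_mono le_sup_left).trans (h0.le.trans (sup_le_sup_right i0 M))
  have k1 : (N m 1).map ψ.toMonoidHom ≤ tripleJoin m ρ ⊔ M :=
    (Subgroup.map_mono le_sup_left).trans (h1.le.trans (sup_le_sup_right i1 M))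
  have k2 : (N m 2).map ψ.toMonoidHom ≤ tripleJoin m ρ ⊔ M :=
    (Subgroup.map_mono le_sup_left).trans (h2.le.trans (sup_le_sup_right i2 M))
  have hψ : Function.Surjective ψ.toMonoidHom := ψ.surjective
  rw [eq_top_iff, ← Subgroup.map_top_of_surjective _ hψ, ← sup_N_eq_top m,
    Subgroup.map_sup, Subgroup.map_sup]
  exact sup_le (sup_le k0 k1) k2

section GenusThree

/-- Homs `S₃ → ℤ/n` (written multiplicatively) from generator values. -/
def homZ (n : ℕ) (v : surfaceGen 3 → Multiplicative (ZMod n)) :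
    SurfaceGroup 3 →* Multiplicative (ZMod n) :=
  SurfaceGroup.toCommGroup v

/-- Every hom `S₃ → ℤ/n` is a `homZ`. -/
theorem eq_homZ {n : ℕ} (f : SurfaceGroup 3 →* Multiplicative (ZMod n)) :
    f = homZ n (fun p => f (PresentedGroup.of p)) :=
  PresentedGroup.ext fun p => by simp [homZ]

/-- The mod-`n` homology level `M_n = [S₃,S₃]·S₃ⁿ = ⋂ ker (S₃ → ℤ/n)`. -/
def Mlevel (n : ℕ) : Subgroup (SurfaceGroup 3) := ⨅ v, (homZ n v).ker

theorem mem_Mlevel {n : ℕ} {s : SurfaceGroup 3} : s ∈ Mlevel n ↔ ∀ v, homZ n v s = 1 := by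
  simp [Mlevel, Subgroup.mem_iInf, MonoidHom.mem_ker]

theorem Mlevel_le_ker {n : ℕ} (f : SurfaceGroup 3 →* Multiplicative (ZMod n)) : Mlevel n ≤ f.ker := by
  intro s hs
  rw [MonoidHom.mem_ker, eq_homZ f]
  exact mem_Mlevel.1 hs _

instance Mlevel_finiteIndex (n : ℕ) [NeZero n] : (Mlevel n).FiniteIndex :=
  Subgroup.finiteIndex_iInf fun _ => inferInstance

theorem Mlevel_characteristic (n : ℕ) : (Mlevel n).Characteristic := by
  refine Subgroup.characteristic_iff_le_comap.2 fun φ s hs => ?_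
  rw [Subgroup.mem_comap, mem_Mlevel]
  intro v
  have := (mem_Mlevel.1 hs) (fun p => homZ n v (φ (PresentedGroup.of p)))
  rw [← MonoidHom.comp_apply, eq_homZ ((homZ n v).comp φ.toMonoidHom)]
  simpa using this

/-- At genus 3 every generator other than `b₀` dies in `N₀ ⊔ N₁` (`N₀ = ⟪a₀,a₁,b₂⟫`,
`N₁ = ⟪a₀,b₁,a₂⟫`): `S₃/(N₀ ⊔ N₁)` is cyclic, generated by the class of `b₀`. -/
theorem of_mem_N01 (p : surfaceGen 3) (hp : p ≠ ((0 : Fin 3), true)) :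
    (PresentedGroup.of p : SurfaceGroup 3) ∈ N 0 0 ⊔ N 0 1 := by
  obtain ⟨k, c⟩ := p
  fin_cases k <;> cases c
  · exact mem_sup_left (of_mem_s4Kernels 0 (by decide))
  · exact absurd rfl hp
  · exact mem_sup_left (of_mem_s4Kernels 0 (by decide))
  · exact mem_sup_right (of_mem_s4Kernels 1 (by decide))
  · exact mem_sup_right (of_mem_s4Kernels 1 (by decide))
  · exact mem_sup_left (of_mem_s4Kernels 0 (by decide))

/-- **Cyclic collapse.** At genus 3, if `G_ρ = S₃/(N₀ ⊔ N₁ ⊔ ρN₂)` dies modulo every mod-`n`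
homology level (`n ≥ 2`), then `G_ρ = 1`: `G_ρ` is cyclic (generated by `b̄₀`), so it is `ℤ/c`
with `c = Nat.card G_ρ`; if `c ≠ 1` the character `G_ρ ≅ ℤ/c ↠ ℤ/n` (`n = c`, or `n = 2` when
`c = 0`) is a non-trivial hom `S₃ → ℤ/n` killing `N₀ ⊔ N₁ ⊔ ρN₂` and `M_n` — impossible. -/
theorem tripleJoin_zero_eq_top_of_levels (ρ : S 0 ≃* S 0)
    (h : ∀ n : ℕ, 2 ≤ n → tripleJoin 0 ρ ⊔ Mlevel n = ⊤) : tripleJoin 0 ρ = ⊤ := by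
  haveI h01 : (N 0 0 ⊔ N 0 1).Normal := Subgroup.sup_normal _ _
  haveI hT : (tripleJoin 0 ρ).Normal := Subgroup.sup_normal _ _
  -- the generator `q = b̄₀` of the quotient
  let q : S 0 ⧸ tripleJoin 0 ρ := QuotientGroup.mk (SurfaceGroup.b 0)
  have hgen : ∀ p : surfaceGen 3,
      (QuotientGroup.mk (PresentedGroup.of p) : S 0 ⧸ tripleJoin 0 ρ) ∈ Subgroup.zpowers q := by
    intro p
    by_cases hp : p = ((0 : Fin 3), true)
    · subst hp
      exact Subgroup.mem_zpowers q
    · have hmem : (PresentedGroup.of p : S 0) ∈ tripleJoin 0 ρ := mem_sup_left (of_mem_N01 p hp)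
      rw [(QuotientGroup.eq_one_iff _).2 hmem]
      exact one_mem _
  have hq : ∀ x : S 0 ⧸ tripleJoin 0 ρ, x ∈ Subgroup.zpowers q := by
    have hcl : (Subgroup.closure (Set.range (PresentedGroup.of : surfaceGen 3 → S 0))).map
        (QuotientGroup.mk' (tripleJoin 0 ρ)) ≤ Subgroup.zpowers q := by
      rw [MonoidHom.map_closure, Subgroup.closure_le]
      rintro _ ⟨_, ⟨p, rfl⟩, rfl⟩
      exact hgen p
    rw [PresentedGroup.closure_range_of, Subgroup.map_top_of_surjective _
      (QuotientGroup.mk'_surjective _)] at hcl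
    exact fun x => hcl (Subgroup.mem_top x)
  -- all generators in `tripleJoin` once `b₀` is
  have key : (SurfaceGroup.b 0 : S 0) ∈ tripleJoin 0 ρ → tripleJoin 0 ρ = ⊤ := by
    intro hb
    have hall : ∀ p : surfaceGen 3, (PresentedGroup.of p : S 0) ∈ tripleJoin 0 ρ := by
      intro p
      by_cases hp : p = ((0 : Fin 3), true)
      · subst hp
        exact hb
      · exact mem_sup_left (of_mem_N01 p hp)
    rw [eq_top_iff, ← PresentedGroup.closure_range_of, Subgroup.closure_le]
    rintro _ ⟨p, rfl⟩
    exact hall p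
  obtain ⟨c, hc⟩ : ∃ c : ℕ, Nat.card (S 0 ⧸ tripleJoin 0 ρ) = c := ⟨_, rfl⟩
  by_cases hc1 : c = 1
  · -- trivial quotient
    haveI : Subsingleton (S 0 ⧸ tripleJoin 0 ρ) := (Nat.card_eq_one_iff_unique.1 (hc.trans hc1)).1
    exact key ((QuotientGroup.eq_one_iff _).1 (Subsingleton.elim _ _))
  · -- a non-trivial character through the cyclic quotient
    exfalso
    obtain ⟨n, hn2, hdvd⟩ : ∃ n : ℕ, 2 ≤ n ∧ n ∣ c := by
      by_cases hc0 : c = 0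
      · exact ⟨2, le_rfl, hc0 ▸ dvd_zero 2⟩
      · exact ⟨c, by omega, dvd_rfl⟩
    haveI : NeZero n := ⟨by omega⟩
    haveI : Fact (1 < n) := ⟨by omega⟩
    let e : Multiplicative (ZMod c) ≃* S 0 ⧸ tripleJoin 0 ρ := zmodMulEquivOfGenerator hq hc
    let cast : Multiplicative (ZMod c) →* Multiplicative (ZMod n) :=
      AddMonoidHom.toMultiplicative (ZMod.castHom hdvd (ZMod n)).toAddMonoidHom
    let w : S 0 →* Multiplicative (ZMod n) :=
      cast.comp (e.symm.toMonoidHom.comp (QuotientGroup.mk' (tripleJoin 0 ρ)))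
    -- `w` kills `tripleJoin` and `M_n`, hence everything
    have hker : tripleJoin 0 ρ ⊔ Mlevel n ≤ w.ker := by
      refine sup_le (fun s hs => ?_) (Mlevel_le_ker w)
      rw [MonoidHom.mem_ker]
      show cast (e.symm (QuotientGroup.mk' _ s)) = 1
      rw [QuotientGroup.mk'_apply, (QuotientGroup.eq_one_iff s).2 hs, map_one, map_one]
    rw [h n hn2] at hker
    have h1 : w (SurfaceGroup.b 0) = 1 := (MonoidHom.mem_ker).1 (hker (Subgroup.mem_top _))
    -- but `w b₀ = 1 mod n ≠ 0`
    have hwb : w (SurfaceGroup.b 0) = Multiplicative.ofAdd (1 : ZMod n) := by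
      show cast (e.symm (QuotientGroup.mk' _ (SurfaceGroup.b 0))) = _
      have he : e.symm q = Multiplicative.ofAdd 1 := zmodMulEquivOfGenerator_symm_apply_generator hq hc
      rw [QuotientGroup.mk'_apply, show (QuotientGroup.mk (SurfaceGroup.b 0) : S 0 ⧸ tripleJoin 0 ρ) = q
        from rfl, he]
      simp [cast, ZMod.cast_one hdvd]
    rw [hwb] at h1
    simp at h1

/-- **No ghosts at genus 3**: every shadow-standard `T_ρ` at `m = 0` glues a simply connected
4-manifold (`N₀ ⊔ N₁ ⊔ ρN₂ = ⊤`). This discharges the private conjunct of the line at the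
first open type `(3; 1,1,1)`, as all three triagers predicted. -/
theorem tripleJoin_eq_top_of_shadowStandard_zero (ρ : S 0 ≃* S 0) (hS : ShadowStandard 0 ρ) :
    tripleJoin 0 ρ = ⊤ :=
  tripleJoin_zero_eq_top_of_levels ρ fun n hn => by
    haveI : NeZero n := ⟨by omega⟩
    exact tripleJoin_sup_eq_top_of_shadowStandardAt
      (hS (Mlevel n) (Mlevel_characteristic n) (Mlevel_finiteIndex n))

/-- **STUB 2 HOLDS AT `m = 0`** (vacuously: there is no Grothendieck flag at genus 3). -/
theorem unitDefectDetectsAt_zero : UnitDefectDetectsAt 0 :=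
  fun ρ _ _ _ _ _ _ hS hG => absurd (tripleJoin_eq_top_of_shadowStandard_zero ρ hS) hG

/-- **The line at genus 3** is pair rigidity plus the fine gate: `HHCC₀ ⟸ PairRigidity₀ ∧ FineGate₀`
(sorry-free; `FineGateAt 0` = ShadowApproximation for `(3;1,1,1)` homotopy-sphere trisections of
the form `(N₀, N₁, ρN₂)` — one notch above the Meier–Zupan genus-2 range). -/
theorem hhccAt_zero_of (hPR : PairRigidityAt 0) (hFG : FineGateAt 0) : HHCCAt 0 :=
  hhccAt_of_stubs 0 hPR unitDefectDetectsAt_zero hFG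

end GenusThree

end Summit.SmoothPoincare4.SmoothPoincare4.Cruxes.HeegaardHandlebodyCongruenceClosed.UnitDefectDichotomy

end
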